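import Literature.NumberTheory.Sieve.QuadraticRootsPrimeModuliDFISieveReindex
import Literature.NumberTheory.Sieve.QuadraticRootsPrimeModuliDFISieveEstimates
import HarnessLib

/-!
# Duke–Friedlander–Iwaniec 1995, §6: the Legendre terms `∑^w μ(d)|C_d|` of Lemmas 1–2

Topic `Literature/NumberTheory/Sieve`.  Towards the discharge of
`Literature.NumberTheory.Sieve.dukeFriedlanderIwaniec1995_theorem5` (W. Duke, J. B. Friedlander,
H. Iwaniec, Ann. of Math. 141 (1995), §6 pp. 434–436).  After Buchstab twice,
`S(C, z) = S(C, w) − ∑_{w ≤ p < z} S(C_p, w) + (double sum)`; by Legendre's identity the first two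
terms are `∑^w_{d ∣ P(z)} μ(d)|C_d|` (`d` with at most one prime factor `≥ w`).  The paper splits
`∑^w_d = ∑^w_{d<D} + ∑^w_{d≥D}`, estimates the first part by the special bilinear forms (32)
`R(D) = ∑_{d<D} λ_d ∑_m c_{dm}` (hypothesis (34)) and the second by (27) and Rankin's trick
(`|∑^w_{d ≥ D}| ≤ 2^{−log(D/z)/log w} G(z)² X`).  Here, in the quotient convention of
`…DFISieveReindex` and with `γ(d) = τ(d)/d`, `X = x(1 + log x)`:

* `DFI1995.norm_legendrePart_le` — if `|c_n| ≤ τ(n)`, `2 ≤ w ≤ z`, `0 < D ≤ x`, `1 ≤ z` and every special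
  bilinear form has `|R(D)| ≤ B₁` (hypothesis (34) at this `x`), then
  `|S(C, w) − ∑_{w ≤ p < z} S(C_p, w)| ≤ 2 B₁ + X F(D) + 2 X G F(D/z)`, where
  `F(E) = 2^{−log E/log w} exp(4(log log w + 4))` is the Rankin bound of `…DFISieveEstimates`
  (`DFI1995.sum_tail_divisors_le`) and `G = log log x + 4`.  The two main parts are the forms `R(D)`
  with `λ_d = μ(d) 1_{d ∣ P(w)}` and `λ_e = ∑_{pd = e} μ(d)` (`w ≤ p < z`, `d ∣ P(w)`; at most one
  term, `DFI1995.card_filter_mul_eq_le_one`).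

Everything here is proved.

## References

* W. Duke, J. B. Friedlander, H. Iwaniec, Ann. of Math. (2) 141 (1995), 423–441, §6 pp. 434–436,
  Lemma 1 (26), (27), (28), Lemma 2 (31), (32), (34). [cite: DukeFriedlanderIwaniec1995, §6 Lemmas 1–2]
-/

namespace Literature.NumberTheory.Sieve

open scoped BigOperators
open Finset Real

namespace DFI1995

noncomputable section

/-! ### `|C_d|` and the special bilinear forms -/

/-- `R(D) = ∑_{d < D} λ_d |C_d|` (`DFI1995.sieveR₁` in terms of `DFI1995.quotSum`). [folklore] -/
theorem sieveR₁_eq_sum_quotSum (c lam : ℕ → ℂ) (x D : ℝ) :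
    sieveR₁ c lam x D = ∑ d ∈ (Icc 1 ⌊x⌋₊).filter (fun d : ℕ => (d : ℝ) < D), lam d * quotSum c x d :=
  rfl

/-- (27) for `|C_d|`: `‖|C_d|‖ ≤ τ(d) (x/d)(1 + log x)` for `d ≥ 1`, `x ≥ 1`.
[cite: DukeFriedlanderIwaniec1995, §6 (27)] -/
theorem norm_quotSum_le {c : ℕ → ℂ} (hc : ∀ n : ℕ, 1 ≤ n → ‖c n‖ ≤ (Nat.divisors n).card)
    {d : ℕ} (hd : 1 ≤ d) {x : ℝ} (hx : 1 ≤ x) :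
    ‖quotSum c x d‖ ≤ (d.divisors.card : ℝ) * (x / d) * (1 + Real.log x) :=
  norm_sum_quotSeq_le hc hd hx (subset_refl _)

/-- The divisors `d < D` of `P(w)` are exactly the `d ≤ x`, `d < D` dividing `P(w)` (`D ≤ x`).
[folklore] -/
theorem filter_dvd_eq_divisors_filter {w x D : ℝ} (hDx : D ≤ x) :
    ((Icc 1 ⌊x⌋₊).filter (fun d : ℕ => (d : ℝ) < D)).filter (fun d : ℕ => d ∣ primesProdBelow w) =
      (primesProdBelow w).divisors.filter (fun d : ℕ => (d : ℝ) < D) := by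
  have hP0 := primesProdBelow_ne_zero w
  ext d
  simp only [Finset.mem_filter, Finset.mem_Icc, Nat.mem_divisors]
  constructor
  · rintro ⟨⟨-, hdD⟩, hdP⟩; exact ⟨⟨hdP, hP0⟩, hdD⟩
  · rintro ⟨⟨hdP, -⟩, hdD⟩
    have hd0 : d ≠ 0 := fun h => hP0 (Nat.eq_zero_of_zero_dvd (h ▸ hdP))
    refine ⟨⟨⟨Nat.one_le_iff_ne_zero.2 hd0, Nat.le_floor (hdD.le.trans hDx)⟩, hdD⟩, hdP⟩

/-- The representation `e = p d` with `w ≤ p < z` prime and `d ∣ P(w)` is unique. [folklore] -/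
theorem card_filter_mul_eq_le_one (w z : ℝ) (e : ℕ) :
    (((primesIco w z) ×ˢ (primesProdBelow w).divisors).filter
      (fun pd : ℕ × ℕ => pd.1 * pd.2 = e)).card ≤ 1 := by
  refine Finset.card_le_one.2 fun a ha b hb => ?_
  simp only [Finset.mem_filter, Finset.mem_product, mem_primesIco, Nat.mem_divisors] at ha hb
  obtain ⟨⟨⟨hap, hwa, -⟩, hadvd, -⟩, hae⟩ := ha
  obtain ⟨⟨⟨hbp, hwb, -⟩, hbdvd, -⟩, hbe⟩ := hb
  -- `a.1 ∣ b.1 * b.2`, and `a.1 ∤ b.2` since the prime factors of `b.2` are `< w ≤ a.1`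
  have h1 : a.1 ∣ b.1 * b.2 := by rw [hbe, ← hae]; exact dvd_mul_right _ _
  have hndvd : ¬ a.1 ∣ b.2 := fun h =>
    absurd ((dvd_primesProdBelow_iff hap w).1 (dvd_trans h hbdvd)) (not_lt.2 hwa)
  have h2 : a.1 ∣ b.1 := (hap.dvd_mul.1 h1).resolve_right hndvd
  have h3 : a.1 = b.1 := (Nat.prime_dvd_prime_iff_eq hap hbp).1 h2
  have h4 : a.2 = b.2 := by
    have : a.1 * a.2 = a.1 * b.2 := by rw [hae, ← hbe, h3]
    exact Nat.eq_of_mul_eq_mul_left hap.pos this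
  exact Prod.ext h3 h4

/-! ### The Legendre part -/

/-- **The Legendre terms** (pp. 434–436): for `|c_n| ≤ τ(n)`, `2 ≤ w ≤ z`, `1 ≤ z`, `0 < D ≤ x` and
`|R(D)| ≤ B₁` for every special bilinear form (32) with `|λ_d| ≤ 1` (hypothesis (34) at this `x`),
`|S(C, w) − ∑_{w ≤ p < z} S(C_p, w)| ≤ 2 B₁ + X F(D) + 2 X G F(D/z)` with `X = x(1 + log x)`,
`G = log log x + 4`, `F(E) = 2^{−log E/log w} exp(4(log log w + 4))`: Legendre's identity for each
term, the parts `d < D` (resp. `pd < D`) being special bilinear forms `R(D)` with `λ = μ·1_{· ∣ P(w)}`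
(resp. `λ_e = ∑_{pd = e} μ(d)`), the tails bounded by (27) and Rankin's trick.
[cite: DukeFriedlanderIwaniec1995, §6 Lemma 2 (31) with (27), (32), (34)] -/
theorem norm_legendrePart_le {c : ℕ → ℂ} (hc : ∀ n : ℕ, 1 ≤ n → ‖c n‖ ≤ (Nat.divisors n).card)
    {x w z D : ℝ} (hw : 2 ≤ w) (hwz : w ≤ z) (hzx : z ≤ x) (hD : 0 < D) (hDx : D ≤ x) {B₁ : ℝ}
    (hB : ∀ lam : ℕ → ℂ, (∀ d : ℕ, ‖lam d‖ ≤ 1) → ‖sieveR₁ c lam x D‖ ≤ B₁) :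
    ‖siftedQ c x 1 w - ∑ p ∈ primesIco w z, siftedQ c x p w‖ ≤
      2 * B₁ + (x * (1 + Real.log x)) *
        (Real.exp (-(Real.log 2 * Real.log D / Real.log w)) * Real.exp (4 * (Real.log (Real.log w) + 4))) +
        2 * (x * (1 + Real.log x)) * (Real.log (Real.log x) + 4) *
        (Real.exp (-(Real.log 2 * Real.log (D / z) / Real.log w)) *
          Real.exp (4 * (Real.log (Real.log w) + 4))) := by
  classical
  have hx2 : 2 ≤ x := hw.trans (hwz.trans hzx)
  have hx1 : 1 ≤ x := by linarith
  have hz0 : 0 < z := by linarith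
  set X : ℝ := x * (1 + Real.log x) with hX
  have hX0 : 0 ≤ X := by have := Real.log_nonneg hx1; positivity
  set P := primesProdBelow w with hP
  have hP0 : P ≠ 0 := primesProdBelow_ne_zero w
  set Dv := P.divisors with hDv
  set FD : ℝ := Real.exp (-(Real.log 2 * Real.log D / Real.log w)) *
    Real.exp (4 * (Real.log (Real.log w) + 4)) with hFD
  set FDz : ℝ := Real.exp (-(Real.log 2 * Real.log (D / z) / Real.log w)) *
    Real.exp (4 * (Real.log (Real.log w) + 4)) with hFDz
  set G : ℝ := Real.log (Real.log x) + 4 with hG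
  -- Legendre for each term
  have hL0 : siftedQ c x 1 w = ∑ d ∈ Dv, ((ArithmeticFunction.moebius d : ℤ) : ℂ) * quotSum c x d := by
    rw [siftedQ_eq_sum_moebius]
    refine Finset.sum_congr rfl fun d _ => by rw [one_mul, zsmul_eq_mul]
  have hLp : ∀ p : ℕ, siftedQ c x p w =
      ∑ d ∈ Dv, ((ArithmeticFunction.moebius d : ℤ) : ℂ) * quotSum c x (p * d) := by
    intro p
    rw [siftedQ_eq_sum_moebius]
    refine Finset.sum_congr rfl fun d _ => by rw [zsmul_eq_mul]
  -- norms of the Möbius coefficients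
  have hμ : ∀ d : ℕ, ‖((ArithmeticFunction.moebius d : ℤ) : ℂ)‖ ≤ 1 := by
    intro d
    rw [Complex.norm_intCast]
    exact_mod_cast ArithmeticFunction.abs_moebius_le_one
  -- divisors of `P` are `≥ 1`
  have hdpos : ∀ d ∈ Dv, 1 ≤ d := fun d hd => Nat.pos_of_mem_divisors hd
  ------------------------------------------------------------------
  -- Main part 0: `∑_{d ∣ P(w), d < D} μ(d)|C_d| = R(D)` with `λ = μ 1_{· ∣ P(w)}`
  ------------------------------------------------------------------
  have hM0 : ‖∑ d ∈ Dv.filter (fun d : ℕ => (d : ℝ) < D),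
      ((ArithmeticFunction.moebius d : ℤ) : ℂ) * quotSum c x d‖ ≤ B₁ := by
    set lam : ℕ → ℂ := fun d => if d ∣ P then ((ArithmeticFunction.moebius d : ℤ) : ℂ) else 0 with hlam
    have hlam1 : ∀ d : ℕ, ‖lam d‖ ≤ 1 := by
      intro d; rw [hlam]; dsimp only; split_ifs
      · exact hμ d
      · simp
    have hid : sieveR₁ c lam x D = ∑ d ∈ Dv.filter (fun d : ℕ => (d : ℝ) < D),
        ((ArithmeticFunction.moebius d : ℤ) : ℂ) * quotSum c x d := by
      rw [sieveR₁_eq_sum_quotSum, hDv, hP, ← filter_dvd_eq_divisors_filter hDx]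
      conv_rhs => rw [Finset.sum_filter]
      refine Finset.sum_congr rfl fun d _ => ?_
      rw [hlam]; dsimp only
      split_ifs <;> simp
    rw [← hid]
    exact hB lam hlam1
  ------------------------------------------------------------------
  -- Main part 1: `∑_{p} ∑_{d ∣ P(w), pd < D} μ(d)|C_{pd}| = R(D)` with `λ_e = ∑_{pd = e} μ(d)`
  ------------------------------------------------------------------
  set T : Finset (ℕ × ℕ) := (primesIco w z) ×ˢ Dv with hT
  have hM1 : ‖∑ p ∈ primesIco w z, ∑ d ∈ Dv.filter (fun d : ℕ => ((p * d : ℕ) : ℝ) < D),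
      ((ArithmeticFunction.moebius d : ℤ) : ℂ) * quotSum c x (p * d)‖ ≤ B₁ := by
    set lam : ℕ → ℂ := fun e => ∑ pd ∈ T.filter (fun pd : ℕ × ℕ => pd.1 * pd.2 = e),
      ((ArithmeticFunction.moebius pd.2 : ℤ) : ℂ) with hlam
    have hlam1 : ∀ e : ℕ, ‖lam e‖ ≤ 1 := by
      intro e
      rw [hlam]; dsimp only
      refine (norm_sum_le _ _).trans ?_
      calc ∑ pd ∈ T.filter (fun pd : ℕ × ℕ => pd.1 * pd.2 = e), ‖((ArithmeticFunction.moebius pd.2 : ℤ) : ℂ)‖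
          ≤ ∑ pd ∈ T.filter (fun pd : ℕ × ℕ => pd.1 * pd.2 = e), (1 : ℝ) :=
            Finset.sum_le_sum fun pd _ => hμ pd.2
        _ = ((T.filter (fun pd : ℕ × ℕ => pd.1 * pd.2 = e)).card : ℝ) := by simp
        _ ≤ 1 := by exact_mod_cast card_filter_mul_eq_le_one w z e
    set E := (Icc 1 ⌊x⌋₊).filter (fun e : ℕ => (e : ℝ) < D) with hE
    have hid : sieveR₁ c lam x D = ∑ p ∈ primesIco w z, ∑ d ∈ Dv.filter
        (fun d : ℕ => ((p * d : ℕ) : ℝ) < D), ((ArithmeticFunction.moebius d : ℤ) : ℂ) * quotSum c x (p * d) := by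
      rw [sieveR₁_eq_sum_quotSum]
      have h1 : ∀ e ∈ E, lam e * quotSum c x e =
          ∑ pd ∈ T.filter (fun pd : ℕ × ℕ => pd.1 * pd.2 = e),
            ((ArithmeticFunction.moebius pd.2 : ℤ) : ℂ) * quotSum c x (pd.1 * pd.2) := by
        intro e _
        rw [hlam]; dsimp only
        rw [Finset.sum_mul]
        refine Finset.sum_congr rfl fun pd hpd => ?_
        rw [(Finset.mem_filter.1 hpd).2]
      rw [Finset.sum_congr rfl h1, Finset.sum_fiberwise_eq_sum_filter T E (fun pd : ℕ × ℕ => pd.1 * pd.2)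
        (fun pd : ℕ × ℕ => ((ArithmeticFunction.moebius pd.2 : ℤ) : ℂ) * quotSum c x (pd.1 * pd.2)),
        hT, Finset.sum_filter, Finset.sum_product]
      refine Finset.sum_congr rfl fun p hp => ?_
      rw [Finset.sum_filter]
      refine Finset.sum_congr rfl fun d hd => ?_
      have hpp : p.Prime := (mem_primesIco.1 hp).1
      have hiff : p * d ∈ E ↔ ((p * d : ℕ) : ℝ) < D := by
        rw [hE, Finset.mem_filter, Finset.mem_Icc]
        constructor
        · exact fun h => h.2
        · intro h
          refine ⟨⟨Nat.mul_pos hpp.pos (hdpos d hd), Nat.le_floor (h.le.trans hDx)⟩, h⟩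
      by_cases hlt : ((p * d : ℕ) : ℝ) < D
      · rw [if_pos (hiff.2 hlt), if_pos hlt]
      · rw [if_neg (fun h => hlt (hiff.1 h)), if_neg hlt]
    rw [← hid]
    exact hB lam hlam1
  ------------------------------------------------------------------
  -- Tail 0: `∑_{d ∣ P(w), d ≥ D} |C_d| ≤ X F(D)`
  ------------------------------------------------------------------
  have hT0 : ‖∑ d ∈ Dv.filter (fun d : ℕ => ¬ (d : ℝ) < D),
      ((ArithmeticFunction.moebius d : ℤ) : ℂ) * quotSum c x d‖ ≤ X * FD := by
    refine (norm_sum_le _ _).trans ?_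
    have h1 : ∀ d ∈ Dv.filter (fun d : ℕ => ¬ (d : ℝ) < D),
        ‖((ArithmeticFunction.moebius d : ℤ) : ℂ) * quotSum c x d‖ ≤ X * ((d.divisors.card : ℝ) / d) := by
      intro d hd
      have hd1 : 1 ≤ d := hdpos d (Finset.mem_filter.1 hd).1
      rw [norm_mul]
      calc ‖((ArithmeticFunction.moebius d : ℤ) : ℂ)‖ * ‖quotSum c x d‖ ≤ 1 * ‖quotSum c x d‖ :=
            mul_le_mul_of_nonneg_right (hμ d) (norm_nonneg _)
        _ ≤ (d.divisors.card : ℝ) * (x / d) * (1 + Real.log x) := by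
            rw [one_mul]; exact norm_quotSum_le hc hd1 hx1
        _ = X * ((d.divisors.card : ℝ) / d) := by rw [hX]; ring
    refine (Finset.sum_le_sum h1).trans ?_
    rw [← Finset.mul_sum]
    refine mul_le_mul_of_nonneg_left ?_ hX0
    have hset : Dv.filter (fun d : ℕ => ¬ (d : ℝ) < D) = Dv.filter (fun d : ℕ => D ≤ (d : ℝ)) :=
      Finset.filter_congr fun d _ => not_lt
    rw [hset]
    exact sum_tail_divisors_le hw hD
  ------------------------------------------------------------------
  -- Tail 1: `∑_p ∑_{d ∣ P(w), pd ≥ D} |C_{pd}| ≤ 2 X G F(D/z)`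
  ------------------------------------------------------------------
  have hT1 : ‖∑ p ∈ primesIco w z, ∑ d ∈ Dv.filter (fun d : ℕ => ¬ ((p * d : ℕ) : ℝ) < D),
      ((ArithmeticFunction.moebius d : ℤ) : ℂ) * quotSum c x (p * d)‖ ≤ 2 * X * G * FDz := by
    have hFDz_bound : ∑ d ∈ Dv.filter (fun d : ℕ => D / z ≤ (d : ℝ)), (d.divisors.card : ℝ) / d ≤ FDz :=
      sum_tail_divisors_le hw (div_pos hD hz0)
    have hFDz0 : 0 ≤ FDz := by rw [hFDz]; positivity
    have hinner : ∀ p ∈ primesIco w z,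
        ‖∑ d ∈ Dv.filter (fun d : ℕ => ¬ ((p * d : ℕ) : ℝ) < D),
          ((ArithmeticFunction.moebius d : ℤ) : ℂ) * quotSum c x (p * d)‖ ≤ 2 * X * FDz * (p : ℝ)⁻¹ := by
      intro p hp
      obtain ⟨hpp, hwp, hpz⟩ := mem_primesIco.1 hp
      have hp0 : (0 : ℝ) < p := by exact_mod_cast hpp.pos
      refine (norm_sum_le _ _).trans ?_
      -- termwise: `|μ(d) C_{pd}| ≤ 2 X p⁻¹ τ(d)/d`
      have h1 : ∀ d ∈ Dv.filter (fun d : ℕ => ¬ ((p * d : ℕ) : ℝ) < D),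
          ‖((ArithmeticFunction.moebius d : ℤ) : ℂ) * quotSum c x (p * d)‖ ≤
            2 * X * (p : ℝ)⁻¹ * ((d.divisors.card : ℝ) / d) := by
        intro d hd
        have hd1 : 1 ≤ d := hdpos d (Finset.mem_filter.1 hd).1
        have hd0 : (0 : ℝ) < d := by exact_mod_cast hd1
        rw [norm_mul]
        have hτ : ((p * d).divisors.card : ℝ) ≤ 2 * (d.divisors.card : ℝ) := by
          have h := card_divisors_mul_le p d
          rw [Nat.Prime.divisors hpp, Finset.card_pair hpp.ne_one.symm] at h
          exact_mod_cast h
        calc ‖((ArithmeticFunction.moebius d : ℤ) : ℂ)‖ * ‖quotSum c x (p * d)‖ ≤ 1 * ‖quotSum c x (p * d)‖ :=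
              mul_le_mul_of_nonneg_right (hμ d) (norm_nonneg _)
          _ ≤ ((p * d).divisors.card : ℝ) * (x / ((p * d : ℕ) : ℝ)) * (1 + Real.log x) := by
              rw [one_mul]; exact norm_quotSum_le hc (Nat.mul_pos hpp.pos hd1) hx1
          _ ≤ (2 * (d.divisors.card : ℝ)) * (x / ((p * d : ℕ) : ℝ)) * (1 + Real.log x) := by
              have : 0 ≤ (x / ((p * d : ℕ) : ℝ)) * (1 + Real.log x) := by
                have := Real.log_nonneg hx1; positivity
              nlinarith
          _ = 2 * X * (p : ℝ)⁻¹ * ((d.divisors.card : ℝ) / d) := by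
              rw [hX]; push_cast; field_simp
      refine (Finset.sum_le_sum h1).trans ?_
      rw [← Finset.mul_sum]
      -- enlarge the range `pd ≥ D` to `d ≥ D/z`
      have hsum : ∑ d ∈ Dv.filter (fun d : ℕ => ¬ ((p * d : ℕ) : ℝ) < D), (d.divisors.card : ℝ) / d ≤ FDz := by
        calc ∑ d ∈ Dv.filter (fun d : ℕ => ¬ ((p * d : ℕ) : ℝ) < D), (d.divisors.card : ℝ) / d
            ≤ ∑ d ∈ Dv.filter (fun d : ℕ => D / z ≤ (d : ℝ)), (d.divisors.card : ℝ) / d := by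
              refine Finset.sum_le_sum_of_subset_of_nonneg (fun d hd => ?_) fun _ _ _ => by positivity
              rw [Finset.mem_filter] at hd ⊢
              refine ⟨hd.1, ?_⟩
              have hle : D ≤ (p : ℝ) * d := by
                have h2 := not_lt.1 hd.2
                push_cast at h2
                exact h2
              rw [div_le_iff₀ hz0]
              have hd0 : (0 : ℝ) ≤ d := Nat.cast_nonneg d
              nlinarith
          _ ≤ FDz := hFDz_bound
      calc 2 * X * (p : ℝ)⁻¹ * ∑ d ∈ Dv.filter (fun d : ℕ => ¬ ((p * d : ℕ) : ℝ) < D), (d.divisors.card : ℝ) / d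
          ≤ 2 * X * (p : ℝ)⁻¹ * FDz := mul_le_mul_of_nonneg_left hsum (by positivity)
        _ = 2 * X * FDz * (p : ℝ)⁻¹ := by ring
    refine (norm_sum_le _ _).trans ((Finset.sum_le_sum hinner).trans ?_)
    rw [← Finset.mul_sum]
    have hG' : ∑ p ∈ primesIco w z, (p : ℝ)⁻¹ ≤ G := by
      refine sum_inv_primes_le_loglog hx2 fun p hp => ?_
      obtain ⟨hpp, -, hpz⟩ := mem_primesIco.1 hp
      exact ⟨hpp, by linarith⟩
    calc 2 * X * FDz * ∑ p ∈ primesIco w z, (p : ℝ)⁻¹ ≤ 2 * X * FDz * G :=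
          mul_le_mul_of_nonneg_left hG' (by positivity)
      _ = 2 * X * G * FDz := by ring
  ------------------------------------------------------------------
  -- assemble
  ------------------------------------------------------------------
  have hsplit0 : siftedQ c x 1 w =
      ∑ d ∈ Dv.filter (fun d : ℕ => (d : ℝ) < D), ((ArithmeticFunction.moebius d : ℤ) : ℂ) * quotSum c x d +
      ∑ d ∈ Dv.filter (fun d : ℕ => ¬ (d : ℝ) < D), ((ArithmeticFunction.moebius d : ℤ) : ℂ) * quotSum c x d := by
    rw [hL0, Finset.sum_filter_add_sum_filter_not]
  have hsplit1 : ∑ p ∈ primesIco w z, siftedQ c x p w =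
      ∑ p ∈ primesIco w z, ∑ d ∈ Dv.filter (fun d : ℕ => ((p * d : ℕ) : ℝ) < D),
        ((ArithmeticFunction.moebius d : ℤ) : ℂ) * quotSum c x (p * d) +
      ∑ p ∈ primesIco w z, ∑ d ∈ Dv.filter (fun d : ℕ => ¬ ((p * d : ℕ) : ℝ) < D),
        ((ArithmeticFunction.moebius d : ℤ) : ℂ) * quotSum c x (p * d) := by
    rw [← Finset.sum_add_distrib]
    refine Finset.sum_congr rfl fun p _ => ?_
    rw [hLp p, Finset.sum_filter_add_sum_filter_not]
  rw [hsplit0, hsplit1]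
  calc ‖∑ d ∈ Dv.filter (fun d : ℕ => (d : ℝ) < D), ((ArithmeticFunction.moebius d : ℤ) : ℂ) * quotSum c x d +
        ∑ d ∈ Dv.filter (fun d : ℕ => ¬ (d : ℝ) < D), ((ArithmeticFunction.moebius d : ℤ) : ℂ) * quotSum c x d -
        (∑ p ∈ primesIco w z, ∑ d ∈ Dv.filter (fun d : ℕ => ((p * d : ℕ) : ℝ) < D),
            ((ArithmeticFunction.moebius d : ℤ) : ℂ) * quotSum c x (p * d) +
          ∑ p ∈ primesIco w z, ∑ d ∈ Dv.filter (fun d : ℕ => ¬ ((p * d : ℕ) : ℝ) < D),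
            ((ArithmeticFunction.moebius d : ℤ) : ℂ) * quotSum c x (p * d))‖
      ≤ ‖∑ d ∈ Dv.filter (fun d : ℕ => (d : ℝ) < D), ((ArithmeticFunction.moebius d : ℤ) : ℂ) * quotSum c x d‖ +
        ‖∑ d ∈ Dv.filter (fun d : ℕ => ¬ (d : ℝ) < D), ((ArithmeticFunction.moebius d : ℤ) : ℂ) * quotSum c x d‖ +
        (‖∑ p ∈ primesIco w z, ∑ d ∈ Dv.filter (fun d : ℕ => ((p * d : ℕ) : ℝ) < D),
            ((ArithmeticFunction.moebius d : ℤ) : ℂ) * quotSum c x (p * d)‖ +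
          ‖∑ p ∈ primesIco w z, ∑ d ∈ Dv.filter (fun d : ℕ => ¬ ((p * d : ℕ) : ℝ) < D),
            ((ArithmeticFunction.moebius d : ℤ) : ℂ) * quotSum c x (p * d)‖) := by
        refine (norm_sub_le _ _).trans (add_le_add (norm_add_le _ _) (norm_add_le _ _))
    _ ≤ B₁ + X * FD + (B₁ + 2 * X * G * FDz) := by linarith
    _ = 2 * B₁ + X * FD + 2 * X * G * FDz := by ring

end

end DFI1995

end Literature.NumberTheory.Sieve
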